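import Mathlib
import Summits.ValiantsHypothesis.ValiantsHypothesis.Theorems.GrenetZeonHessianRankCodimTwoLatinBlockTable
import Summits.ValiantsHypothesis.ValiantsHypothesis.Theorems.GrenetZeonHessianRankCodimTwoLatinFrobeniusBlock
import Summits.ValiantsHypothesis.ValiantsHypothesis.Theorems.GrenetZeonHessianRankCodimTwoLatinPhiBridge
import HarnessLib

/-!
# The Latin block plane, `r = 0`: BRIDGE between the fibre count (part B) and the generating functions (part A)

Crux `GrenetZeon.HessianRankCodimTwo` (stmt-ValiantsHypothesis-8061), line `good_plane`, Theorem P.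
Part B (`…LatinTable.lean`, `…LatinBlockTable.lean`) writes the permanent and the block values of the
Latin block point as `(p!)³ • permTable p` and `((p−2)!·p!·p!) • blockTable p hp I J` (sums over
colourings with prescribed fibre sizes); part A (`…LatinFrobenius*.lean`, seat 8061-p3) defines
`latinPhi R p`, `latinPsi R p I J` as COEFFICIENTS of products of the circulant row forms and proves
`coeff_ν (Π_r ℓ_{blk r}) = Σ_{g : |g⁻¹K| = ν K} Π_r X_{g r − blk r}` (`coeff_prod_rowForm_card`) and the
characteristic-`p` congruences.  This file identifies the two:

* `permTable p = latinPhi ℤ p` is `…LatinPhiBridge.lean` (seat 8061-p2, `permTable_eq_latinPhi`), used here;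
* `blockTable p hp I J = latinPsi ℤ p I J` (rows of block `I` minus two,
  `Π_r ℓ_{rowBlock r} = ℓ_I^{p−2} ℓ_{I+1}^p ℓ_{I+2}^p`);

hence `permPoly p = (p!)³ • latinPhi ℤ p`, `blockPoly p hp I J = ((p−2)!·p!·p!) • latinPsi ℤ p I J`, and
over `ℂ`: the permanent (resp. the block value `h_{IJ}`) of the Latin point with coordinates `a`
vanishes iff `aeval a (latinPhi ℤ p) = 0` (resp. `aeval a (latinPsi ℤ p I J) = 0`) — the input of the
reduction modulo `p` (`exists_charP_commonZero`, part C).  VP ≠ VNP is not moved by anything here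
(bookkeeping inside the family `n = 3p` of the constant-factor crux).
-/

noncomputable section

open MvPolynomial Finset Equiv
open Literature.Computability.AlgebraicComplexity

-- single-conjunct layout `Summits/ValiantsHypothesis/ValiantsHypothesis`: duplicated namespace by design
set_option linter.dupNamespace false

namespace Summit.ValiantsHypothesis.ValiantsHypothesis.Theorems.GrenetZeonHessianRankCodimTwo

section Bridge

variable {p : ℕ}

/-- The exponent vector `Σ_K c_K e_K` evaluated at `K` is `c_K`. [folklore] -/
theorem sum_single_apply_fin_three (c : Fin 3 → ℕ) (K : Fin 3) :
    (∑ K' : Fin 3, Finsupp.single K' (c K')) K = c K := by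
  rw [Finsupp.finsetSum_apply]
  simp only [Finsupp.single_apply]
  rw [Finset.sum_ite_eq' univ K c, if_pos (Finset.mem_univ K)]

/-- `Π_K f K ^ (a if K = I else b) = f I ^ a · (f (I+1) ^ b · f (I+2) ^ b)` over `Fin 3`. [folklore] -/
theorem prod_pow_ite_fin_three {M : Type*} [CommMonoid M] (I : Fin 3) (f : Fin 3 → M) (a b : ℕ) :
    ∏ K : Fin 3, f K ^ (if K = I then a else b) = f I ^ a * (f (I + 1) ^ b * f (I + 2) ^ b) := by
  rw [← Finset.mul_prod_erase univ _ (Finset.mem_univ I), if_pos rfl,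
    Finset.prod_congr rfl fun K hK =>
      (show f K ^ (if K = I then a else b) = f K ^ b by rw [if_neg (Finset.ne_of_mem_erase hK)]),
    prod_univ_erase_fin_three I (fun K => f K ^ b)]

/-- **Bridge for the block values:** the colouring table `blockTable p hp I J` (part B) is the
coefficient `latinPsi ℤ p I J = [y^{(p,p,p)−2e_J}] ℓ_I^{p−2} ℓ_{I+1}^p ℓ_{I+2}^p` (part A). [folklore] -/
theorem blockTable_eq_latinPsi (hp : 2 ≤ p) (I J : Fin 3) :
    blockTable p hp I J = latinPsi ℤ p I J := by
  unfold latinPsi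
  rw [← prod_pow_ite_fin_three I (rowForm ℤ) (p - 2) p, ← prod_subtype_comp_rowBlock_eq hp I (rowForm ℤ),
    coeff_prod_rowForm_card (R := ℤ)
      (fun r : {r : Fin (3 * p + 0) // r ≠ blockIdx p 0 hp I 0 ∧ r ≠ blockIdx p 0 hp I 1} =>
        rowBlock p r.1)
      (∑ K : Fin 3, Finsupp.single K (if K = J then p - 2 else p))]
  unfold blockTable
  refine Finset.sum_congr ?_ fun _ _ => rfl
  ext u
  simp only [Finset.mem_filter, Finset.mem_univ, true_and]
  refine forall_congr' fun K => ?_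
  rw [Fintype.card_subtype, sum_single_apply_fin_three (fun K => if K = J then p - 2 else p) K]

/-- **Theorem P, table identity for the permanent (final form):**
`permPoly p = (p!)³ • Φ̃_p` with `Φ̃_p = latinPhi ℤ p`. [folklore] -/
theorem permPoly_eq_smul_latinPhi (hp : 0 < p) :
    permPoly p = (p.factorial ^ 3) • latinPhi ℤ p := by
  rw [permPoly_eq_smul_permTable hp, permTable_eq_latinPhi hp]

/-- **Theorem P, table identity for the block values (final form):**
`blockPoly p hp I J = ((p−2)!·p!·p!) • Ψ̃_{IJ}` with `Ψ̃_{IJ} = latinPsi ℤ p I J`. [folklore] -/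
theorem blockPoly_eq_smul_latinPsi (hp : 2 ≤ p) (I J : Fin 3) :
    blockPoly p hp I J = ((p - 2).factorial * p.factorial * p.factorial) • latinPsi ℤ p I J := by
  rw [blockPoly_eq_smul_blockTable hp, blockTable_eq_latinPsi hp]

/-- The permanent of the Latin block point (`r = 0`) is `(p!)³ · Φ̃_p(a)`, `Φ̃_p = latinPhi ℤ p`.
[folklore] -/
theorem eval_perPoly_latinPoint_zero_eq_mul_latinPhi (hp : 0 < p) (a : Fin 3 → ℂ) :
    MvPolynomial.eval (latinPoint p 0 a) (perPoly (Fin (3 * p + 0)) ℂ) =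
      ((p.factorial ^ 3 : ℕ) : ℂ) * aeval a (latinPhi ℤ p) := by
  rw [eval_perPoly_latinPoint_zero_eq_mul_permTable hp, permTable_eq_latinPhi hp]

/-- The block value `h_{IJ}` of the Latin block point (`r = 0`) is `(p−2)!·p!·p! · Ψ̃_{IJ}(a)`,
`Ψ̃_{IJ} = latinPsi ℤ p I J`. [folklore] -/
theorem latinBlockValue_zero_eq_mul_latinPsi (hp : 2 ≤ p) (a : Fin 3 → ℂ) (I J : Fin 3) :
    latinBlockValue p 0 hp a I J =
      (((p - 2).factorial * p.factorial * p.factorial : ℕ) : ℂ) * aeval a (latinPsi ℤ p I J) := by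
  rw [latinBlockValue_zero_eq_mul_blockTable hp, blockTable_eq_latinPsi hp]

/-- **Input of the reduction mod `p` (permanent).** On the Latin block plane (`r = 0`, any `p > 0`)
the permanent vanishes at the point with coordinates `a` iff the integer form `latinPhi ℤ p`
(homogeneous of degree `3p`, `latinPhi_isHomogeneous`) vanishes at `a`. [folklore] -/
theorem eval_perPoly_latinPoint_zero_eq_zero_iff_latinPhi (hp : 0 < p) (a : Fin 3 → ℂ) :
    MvPolynomial.eval (latinPoint p 0 a) (perPoly (Fin (3 * p + 0)) ℂ) = 0 ↔
      aeval a (latinPhi ℤ p) = 0 := by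
  rw [eval_perPoly_latinPoint_zero_eq_zero_iff hp, permTable_eq_latinPhi hp]

/-- **Input of the reduction mod `p` (block values).** On the Latin block plane (`r = 0`, `p ≥ 2`)
the block value `h_{IJ}` vanishes at the point with coordinates `a` iff the integer form
`latinPsi ℤ p I J` (homogeneous of degree `3p − 2`, `latinPsi_isHomogeneous`) vanishes at `a`.
[folklore] -/
theorem latinBlockValue_zero_eq_zero_iff_latinPsi (hp : 2 ≤ p) (a : Fin 3 → ℂ) (I J : Fin 3) :
    latinBlockValue p 0 hp a I J = 0 ↔ aeval a (latinPsi ℤ p I J) = 0 := by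
  rw [latinBlockValue_zero_eq_zero_iff hp, blockTable_eq_latinPsi hp]

end Bridge

end Summit.ValiantsHypothesis.ValiantsHypothesis.Theorems.GrenetZeonHessianRankCodimTwo
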